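import Literature.IUT.LogThetaLattice.PacketLogVolumesHaarModelRelativeTensorDegreeSingleton
import Literature.IUT.LogThetaLattice.GlobalKummerNonInterferenceRemark3101iiiHaarModelCapsules
import HarnessLib

/-!
# [IUTchIII] Remark 3.10.1 (iii) — the degree ESTIMATE at the RELATIVE genuine `A`-packet Haar model
# (`K ⊋ F_mod` along a section `V̲ ⥲ 𝕍_mod`), every finite nonempty label set `A` (abc-iut cell, layer L6;
# L-F register row LF6-11, F-2097; proof-only, no definitions)

S. Mochizuki, *Inter-universal Teichmüller theory III*, kurims manuscript (May 2020), §3, Remark 3.10.1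
(iii), p. 150 [claim: Mochizuki2012, status: disputed]: "one may nevertheless compute — i.e., … 'estimate'
— the global arithmetic degrees of objects of '`𝓕⊛_𝔪𝔬𝔡`' by computing log-volumes [cf. Proposition 3.9,
(iii)], which are bi-coric". Typed schema: `Literature.IUT.LogThetaLattice.Remark3101iii_estimate deg regionOf
vol := ∀ 𝔍 S, regionOf 𝔍 ⊆ S → deg 𝔍 ≤ vol S` (abc-iut-L6-t4, p407875; ∀-closure refuted p452607 — the instance
forms are the content).

Third companion (after `GlobalKummerNonInterferenceRemark3101iiiHaarModel.lean`, the `|A| = 1` genuine adelic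
model with `K = F_mod`, and `…HaarModelCapsules.lean`, the genuine `A`-packet model with `K = F_mod`). THIS FILE:
the print's own setting `K ⊋ F_mod` with a section `V̲ ⥲ 𝕍_mod` of the places ([IUTchI] Def. 3.1 (e)) — the
RELATIVE genuine `A`-packet model of abc-iut-w5-d083 / abc-iut-L6-d3 (`PacketLogVolumesHaarModelRelativeTensor`
p421698, `…RelativeTensorDegreeSingleton` p429646): portions `⊗_{α,ℚ_p} K_{v̲_α}` resp. `⊗_{α,ℝ} ℂ = ⊗_α K_{τ(w_α)}`
at the lifted tuples of places (`relPortionDatum σ τ A` = the genuine portions of `K` pulled back along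
`F_mod → K`, `CapsuleDatum.comap` — same carriers, admissible subsets and log-volumes), `vol` = the global
log-volume `globalLogVolume (relCapsulePacketLogVolume σ τ A)`, regions of `𝔍 = {J_v}` (an arithmetic line
bundle on `F_mod`, `IdealFamily F`) in the label `α` = `relIdealCapsuleRegion σ τ A α`, `deg 𝔍 = deg(𝔞_𝔍) =
deg_{F_mod}(𝔞_𝔍)/[F_mod:ℚ]` (campaign-S `ndeg`), containment = portionwise inclusion of the underlying admissible
subsets (inline anonymous-constructor term for the schema's `HasSubset` argument; no instance declared, the
conclusion head is the FACT decl):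

* `relPortionDatum_logVol_mono_of_adm` — the relative portion log-volume is monotone on ADMISSIBLE subsets
  (it IS the `K`-side genuine log-volume: campaign-S `tensorLogVolume_mono` at `p`, `nlogVol_mono` at `∞`);
* `relCapsulePacketLogVolume_mono`, `globalLogVolume_relHaarModelCapsules_mono` — hence so are
  `μ^log_{A,v_ℚ}` and `μ^log_{A,𝕍_ℚ}` (positive portion weights, `portionWeight_pos` of the capsules companion);
* **`remark3101iii_estimate_haarModelRelCapsules (σ) (τ) (A) (α)`** — **F-2097 / IUTchIII:Rmk3.10.1(iii) HOLDS at
  the relative genuine `A`-packet model** for every `K ⊇ F_mod`, every section, every `A`, every label: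
  `region_α(𝔍) ⊆ S ⇒ deg(𝔞_𝔍) ≤ μ^log_{A,𝕍_ℚ}(S)`, via abc-iut-L6-d3's `globalLogVolume_relIdealCapsuleRegion_eq_ndeg`
  (Prop. 3.9 (iii) at the relative model, all capsule sizes); `…'` (`deg_F(𝔍)/[F:ℚ]` displayed), `…_sharp`,
  `isLeast_globalLogVolume_relIdealCapsuleRegion` — attained at `region_α(𝔍)`; `exists_…` — the section binders
  are inhabited (campaign-S `PlaceSection.nonempty`, Mathlib `InfinitePlace.comap_surjective`).

HONEST FRAMING: instance form at OUR relative genuine model (Haar measure on the real tensor packets of the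
completions of `K` + Arakelov degree on `F_mod`), for the ideal-family objects; not the ∀-closure of the typed
schema (refuted), no Frobenioid `𝓕⊛_𝔪𝔬𝔡` constructed, the log-Kummer distortions of the Remark not modelled; the
archimedean `⊗_ℝ ℂ` portions are faithful for complex places (as in p421698); no side taken on [IUTchIII]
Cor. 3.12; typed ≠ proved; nothing here asserts abc proved or refuted.
-/

namespace Literature.IUT.LogThetaLattice

open Literature.IUT.LogVolume Literature.IUT.LogVolume.ArchPacket Literature.IUT.LogVolume.Prop15iii
  Literature.NumberTheory.NumberFields NumberField IsDedekindDomain MeasureTheory Set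
open scoped ENNReal

variable {F K : Type} [Field F] [NumberField F] [Field K] [NumberField K] [Algebra F K]
  (σ : PlaceSection F K) (τ : InfinitePlace F → InfinitePlace K) (hτ : ∀ w, (τ w).comap (algebraMap F K) = w)
variable (A : Type) [Fintype A] [DecidableEq A] [Nonempty A]

/-! ### Monotonicity of the relative genuine portion log-volumes -/

/-- On ADMISSIBLE subsets the relative portion log-volume `μ^log_π` — the genuine log-volume of the portion
`⊗_α K_{v̲_α}` resp. `⊗_{α,ℝ} ℂ` of `K`, unchanged by the pull-back along `F_mod → K` (`CapsuleDatum.comap_logVol`) —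
is monotone: campaign-S `tensorLogVolume_mono` ([IUTchIV] Prop. 1.4 (i)) at `p`, `nlogVol_mono` (Prop. 1.5 (iii))
at `∞`. [claim: Mochizuki2012, status: disputed] -/
theorem relPortionDatum_logVol_mono_of_adm (q : RatPlace) (π : Portion F A q)
    (S T : (relPortionDatum σ τ A q π).Adm) (h : (S.1 : Set (relPortionDatum σ τ A q π).X) ⊆ T.1) :
    (relPortionDatum σ τ A q π).logVol S.1 ≤ (relPortionDatum σ τ A q π).logVol T.1 := by
  rcases q with ⟨⟩ | p
  · obtain ⟨S, hS⟩ := S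
    obtain ⟨T, hT⟩ := T
    show packetLogVol _ S ≤ packetLogVol _ T
    exact nlogVol_mono _ (image_mono h) hS.1 hT.2
  · haveI : Fact (p : ℕ).Prime := ⟨p.2⟩
    obtain ⟨S, hS⟩ := S
    obtain ⟨T, hT⟩ := T
    show tensorLogVolume p _ S ≤ tensorLogVolume p _ T
    exact tensorLogVolume_mono p _ hS.1 hT.2 h

/-- **[IUTchIII] Prop. 3.9 (i)** (p. 115) at the relative genuine `A`-packet model: `μ^log_{A,v_ℚ}` is monotone under
portionwise inclusion of admissible regions. [claim: Mochizuki2012, status: disputed] -/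
theorem relCapsulePacketLogVolume_mono (q : RatPlace) {S T : ∀ π : Portion F A q, (relPortionDatum σ τ A q π).Adm}
    (h : ∀ π, ((S π).1 : Set (relPortionDatum σ τ A q π).X) ⊆ (T π).1) :
    relCapsulePacketLogVolume σ τ A q S ≤ relCapsulePacketLogVolume σ τ A q T := by
  unfold relCapsulePacketLogVolume
  exact Finset.sum_le_sum fun π _ =>
    mul_le_mul_of_nonneg_left (relPortionDatum_logVol_mono_of_adm σ τ A q π _ _ (h π))
      (portionWeight_pos F A q π).le

/-- **[IUTchIII] Prop. 3.9 (iii)** (p. 117) at the relative genuine `A`-packet model: the global log-volume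
`μ^log_{A,𝕍_ℚ} = Σ_{v_ℚ} μ^log_{A,v_ℚ}` is monotone under portionwise inclusion of global regions.
[claim: Mochizuki2012, status: disputed] -/
theorem globalLogVolume_relHaarModelCapsules_mono {S T : GlobalRegion (relCapsulePacketLogVolume σ τ A)}
    (h : ∀ (q : RatPlace) (π : Portion F A q),
      ((S.1 q π).1 : Set (relPortionDatum σ τ A q π).X) ⊆ (T.1 q π).1) :
    globalLogVolume (relCapsulePacketLogVolume σ τ A) S ≤ globalLogVolume (relCapsulePacketLogVolume σ τ A) T := by
  unfold globalLogVolume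
  exact finsum_le_finsum' S.2 T.2 fun q => relCapsulePacketLogVolume_mono σ τ A q (h q)

/-! ### Remark 3.10.1 (iii) at the relative genuine `A`-packet model -/

/-- **F-2097 / IUTchIII:Rmk3.10.1(iii)** (kurims p. 150) HOLDS AT THE RELATIVE GENUINE `A`-PACKET HAAR MODEL — `K ⊇
F_mod` any finite extension of number fields, `σ`/`τ` any section of the finite / archimedean places, `A` any
finite nonempty label set, `α ∈ A` any label: for the objects `𝔍 = {J_v}` (arithmetic line bundles on `F_mod`,
`IdealFamily F`), their genuine regions in the label `α` of the relative portions (`relIdealCapsuleRegion σ τ A α`: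
`ι_α(ϖ_{v_α}^{-n_{v_α}})·(R_I)^∼ ⊆ ⊗_β K_{v̲_β}` at `p`, the `α`-dilated unit polydisc at `∞`), the normalised
arithmetic degree `deg(𝔞_𝔍) = deg_{F_mod}(𝔞_𝔍)/[F_mod:ℚ]` (campaign-S `ndeg`) and the global log-volume of
Proposition 3.9 (iii) built from the genuine tensor-packet measures of `K` (`relCapsulePacketLogVolume`),
containment being portionwise inclusion: `region_α(𝔍) ⊆ S ⇒ deg(𝔞_𝔍) ≤ μ^log_{A,𝕍_ℚ}(S)`.
[claim: Mochizuki2012, status: disputed] -/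
theorem remark3101iii_estimate_haarModelRelCapsules (α : A) :
    @Remark3101iii_estimate (IdealFamily F) (GlobalRegion (relCapsulePacketLogVolume σ τ A))
      ⟨fun S T => ∀ (q : RatPlace) (π : Portion F A q),
        ((S.1 q π).1 : Set (relPortionDatum σ τ A q π).X) ⊆ (T.1 q π).1⟩
      (fun J => ndeg F J.toADivisor) (relIdealCapsuleRegion σ τ A α)
      (globalLogVolume (relCapsulePacketLogVolume σ τ A)) := by
  intro J S hS
  show ndeg F J.toADivisor ≤ _
  rw [← globalLogVolume_relIdealCapsuleRegion_eq_ndeg σ τ A α J]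
  exact globalLogVolume_relHaarModelCapsules_mono σ τ A hS

/-- The same estimate with the degree displayed as `deg_F(𝔍)/[F:ℚ]`. [claim: Mochizuki2012, status: disputed] -/
theorem remark3101iii_estimate_haarModelRelCapsules' (α : A) :
    @Remark3101iii_estimate (IdealFamily F) (GlobalRegion (relCapsulePacketLogVolume σ τ A))
      ⟨fun S T => ∀ (q : RatPlace) (π : Portion F A q),
        ((S.1 q π).1 : Set (relPortionDatum σ τ A q π).X) ⊆ (T.1 q π).1⟩
      (fun J => J.deg / Module.finrank ℚ F) (relIdealCapsuleRegion σ τ A α)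
      (globalLogVolume (relCapsulePacketLogVolume σ τ A)) := by
  intro J S hS
  show J.deg / Module.finrank ℚ F ≤ _
  rw [← globalLogVolume_relIdealCapsuleRegion σ τ A α J]
  exact globalLogVolume_relHaarModelCapsules_mono σ τ A hS

/-- **Sharpness**: the estimate is attained at `region_α(𝔍)` itself (`μ^log_{A,𝕍_ℚ}(region_α 𝔍) = deg(𝔞_𝔍)`,
abc-iut-L6-d3's `globalLogVolume_relIdealCapsuleRegion_eq_ndeg`). [claim: Mochizuki2012, status: disputed] -/
theorem remark3101iii_estimate_haarModelRelCapsules_sharp (α : A) (J : IdealFamily F) :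
    ∃ S : GlobalRegion (relCapsulePacketLogVolume σ τ A),
      (∀ (q : RatPlace) (π : Portion F A q),
        (((relIdealCapsuleRegion σ τ A α J).1 q π).1 : Set (relPortionDatum σ τ A q π).X) ⊆ (S.1 q π).1) ∧
      globalLogVolume (relCapsulePacketLogVolume σ τ A) S = ndeg F J.toADivisor :=
  ⟨relIdealCapsuleRegion σ τ A α J, fun _ _ => Subset.rfl, globalLogVolume_relIdealCapsuleRegion_eq_ndeg σ τ A α J⟩

/-- **"compute … the global arithmetic degrees … by computing log-volumes"** at the relative genuine model:
`deg(𝔞_𝔍)` is the LEAST global log-volume of a global region containing `region_α(𝔍)` portionwise.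
[claim: Mochizuki2012, status: disputed] -/
theorem isLeast_globalLogVolume_relIdealCapsuleRegion (α : A) (J : IdealFamily F) :
    IsLeast {μ : ℝ | ∃ S : GlobalRegion (relCapsulePacketLogVolume σ τ A),
        (∀ (q : RatPlace) (π : Portion F A q),
          (((relIdealCapsuleRegion σ τ A α J).1 q π).1 : Set (relPortionDatum σ τ A q π).X) ⊆ (S.1 q π).1) ∧
        globalLogVolume (relCapsulePacketLogVolume σ τ A) S = μ} (ndeg F J.toADivisor) := by
  refine ⟨remark3101iii_estimate_haarModelRelCapsules_sharp σ τ A α J, ?_⟩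
  rintro μ ⟨S, hS, rfl⟩
  exact remark3101iii_estimate_haarModelRelCapsules σ τ A α J S hS

variable (F K) in
/-- **Binder-free form**: for every finite extension `K ⊇ F_mod` of number fields, every finite nonempty `A` and every
label `α`, SOME section of the places carries the estimate (the section binders are inhabited: campaign-S
`PlaceSection.nonempty`, Mathlib `InfinitePlace.comap_surjective`) — non-vacuity of `σ`, `τ`.
[claim: Mochizuki2012, status: disputed] -/
theorem exists_remark3101iii_estimate_haarModelRelCapsules (α : A) :
    ∃ (σ : PlaceSection F K) (τ : InfinitePlace F → InfinitePlace K),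
      (∀ w, (τ w).comap (algebraMap F K) = w) ∧
      @Remark3101iii_estimate (IdealFamily F) (GlobalRegion (relCapsulePacketLogVolume σ τ A))
        ⟨fun S T => ∀ (q : RatPlace) (π : Portion F A q),
          ((S.1 q π).1 : Set (relPortionDatum σ τ A q π).X) ⊆ (T.1 q π).1⟩
        (fun J => ndeg F J.toADivisor) (relIdealCapsuleRegion σ τ A α)
        (globalLogVolume (relCapsulePacketLogVolume σ τ A)) := by
  obtain ⟨σ'⟩ := PlaceSection.nonempty F K
  exact ⟨σ', fun w => (InfinitePlace.comap_surjective (K := K) w).choose,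
    fun w => (InfinitePlace.comap_surjective (K := K) w).choose_spec,
    remark3101iii_estimate_haarModelRelCapsules σ' _ A α⟩

end Literature.IUT.LogThetaLattice
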